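import Literature.IUT.HodgeTheaters.TemperedGraphGroupDataOfProp36
import Literature.AnabelianGeometry.SemiGraphs.TemperedSpecialFibre
import Literature.AnabelianGeometry.SemiGraphs.TemperedCurveBridge
import Literature.AnabelianGeometry.SemiGraphs.TemperedDeltaCompletion
import Literature.AnabelianGeometry.SemiGraphs.TemperedCompletionExtension
import HarnessLib

/-!
# Bridge: the [IUTchI] §2 𝔛-data `StableCurveTemperedData` of a tempered curve with special-fibre data

Mochizuki, *Inter-universal Teichmüller theory I*, kurims manuscript (May 2020), §2 pp. 46–47: "Let `𝔛`
be a stable log curve over `Spf 𝒪_k` … `𝔾` the associated pro-`Σ` semi-graph of anabelioids … the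
tempered fundamental group `Π^tp_X` … its profinite completion `Π̂_X` … `Δ^tp_X`, `Δ̂_X` … natural
surjections `Δ^tp_X ↠ Π^tp_𝔾`, `Δ̂_X ↠ Π̂_𝔾`" [cite: Mochizuki2012, IUTchI §2 pp.46-47] (D-0012 claim
key; nothing of the series is asserted here), over Mochizuki, *Semi-graphs of anabelioids*, Publ. RIMS
**42** (2006), §6 p. 69 and Ex. 3.10 pp. 43–45 [cite: MochizukiSemiAnbd2006, §6 p.69; Ex 3.10 pp.43-45].

BRIDGE (abc-iut L3 → L5; the 𝔛-level twin of `TemperedGraphGroupDataOfProp36.lean`; prover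
abc-iut-L5-t11).  L5's INTERFACE DATA `StableCurveTemperedData` (`TemperedCoverings.lean`, abc-iut-L5-t1)
receives an inhabitant from the REAL objects of the L3 tree: `X : TemperedCurve p` ([SemiAnbd] §6
interface: `Π^temp_{X_K} ↪ Π_{X_K}`, augmentations, points / cusps / decomposition groups) with its
parameter bundle `d : X.GroupLevelData` ("tempered, temp-slim, Galois-countable", `TemperedCurveBridge`),
and `S : SpecialFibreData (X.toTemperedArithmeticGroup d)` ([SemiAnbd] Ex. 3.10, abc-iut-L3-t2: the
special-fibre semi-graph of anabelioids `G^c`, a chart of `π₁^temp(G^c)`, the ADMISSIBLE QUOTIENT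
`Δ^temp_X ↠ π₁^temp(G^c)`).  `Π̂_𝔾 :=` a universe-0 profinite completion of `π₁^temp(G^c)` with
injective completion map (`TemperedGraphGroupData.ofChart`, the any-chart form of abc-iut-L3-t7's
`ofProp36`: `ofProp36 = ofChart _ _ (𝒢.temperedPiChart h36)` by `rfl`).  `Δ̂_X ↠ Π̂_𝔾` is CONSTRUCTED,
hypothesis-free: `Ker(Π_{X_K} → G_K) = Δ_X` is the profinite completion of `Δ^temp_X`
(`TemperedCurve.ker_augHat_eq_deltaHat` / `isProfiniteCompletion_deltaToHat`, abc-iut-w5-d139), so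
`Δ^temp_X ↠ π₁^temp(G^c) ↪ Π̂_𝔾` extends (`IsProfiniteCompletion.exists_extension`), surjectively
(compact image containing a dense subgroup).  PARAMETERS, as in `ofProp36` and L3's origin predicates:
the prime-set labels `Σ ⊆ Σ̂`, `p ∉ Σ` (the `Σ`-content "`𝔾` = pro-`Σ` completion of `G^c`" is carried
by L3's `SpecialFibreOrigin` / `ProSigmaOrigin`, not here; print-faithful reading at `Σ̂ = 𝔓𝔯𝔦𝔪𝔢𝔰`),
`Π^tp_ℍ ≤ Π^tp_𝔾`, `Π̂_ℍ ≤ Π̂_𝔾`, and the Cor. 2.3 (vi)(b) atom `cuspMeetsH`.  HONESTY: model-RELATIVE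
inhabitant (∀ `X`, `d`, `S`); that a given curve admits such `S` is L3's `SpecialFibreOrigin`, not
asserted.  Payoff (proof-only companion `…OfSpecialFibreCor25.lean`): the Cor. 2.5 merge atoms
"`D_x` compact", "`D_x ↠` open `⊆ G_k`", "`I_x ≅ Ẑ`", "`G_k` compact infinite" become THEOREMS here.
Typed ≠ discharged; nothing here bears on [IUTchIII] Cor. 3.12.
-/

noncomputable section

namespace Literature.IUT.HodgeTheaters

open CategoryTheory Topology
open Literature.AnabelianGeometry.SemiGraphs Literature.AnabelianGeometry.SemiGraphs.ProfiniteSemiGraph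

universe u

/-! ### The 𝔾-data of an arbitrary chart of `π₁^temp(𝒢)` -/

namespace TemperedGraphGroupData

/-- **[IUTchI] §2 𝔾-data of a graph of anabelioids, for an ARBITRARY chart `c` of `π₁^temp(𝒢)`**
(`Π^tp_𝔾 := c.G`, `Π̂_𝔾 :=` the universe-`u` profinite completion chosen by
`exists_completion_of_prop36 𝒢 h36 c`, with its injective completion map; prime sets and
`Π^tp_ℍ ≤ Π^tp_𝔾`, `Π̂_ℍ ≤ Π̂_𝔾` parameters) — the any-chart form of `ofProp36`, needed because L3's
`SpecialFibreData` carries an arbitrary chart of `π₁^temp(G^c)`. ([IUTchI] §2 pp.44-45) [claim: Mochizuki2012, status: disputed] -/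
def ofChart (𝒢 : ProfiniteSemiGraph.{u}) (h36 : 𝒢.Prop36Hypotheses) (c : TemperedPiChart 𝒢)
    (Sigma SigmaHat : Set ℕ) (hsub : Sigma ⊆ SigmaHat) (hne : Sigma.Nonempty)
    (hprime : ∀ p ∈ SigmaHat, p.Prime)
    (TpH : Subgroup c.G)
    (HatH : Subgroup (exists_completion_of_prop36 𝒢 h36 c).choose)
    (hle : TpH.map (exists_completion_of_prop36 𝒢 h36 c).choose_spec.choose.toMonoidHom ≤ HatH) :
    TemperedGraphGroupData.{u} where
  Sigma := Sigma
  SigmaHat := SigmaHat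
  sigma_subset := hsub
  sigma_nonempty := hne
  sigmaHat_prime := hprime
  Tp := c.G
  Hat := (exists_completion_of_prop36 𝒢 h36 c).choose
  ι := (exists_completion_of_prop36 𝒢 h36 c).choose_spec.choose.toMonoidHom
  ι_continuous := (exists_completion_of_prop36 𝒢 h36 c).choose_spec.choose.continuous
  ι_injective := (exists_completion_of_prop36 𝒢 h36 c).choose_spec.choose_spec.2
  TpH := TpH
  HatH := HatH
  tpH_le := hle

/-- `ofProp36` IS `ofChart` at the canonical chart `𝒢.temperedPiChart h36` (definitional).
([IUTchI] §2 pp.44-45) [claim: Mochizuki2012, status: disputed] -/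
theorem ofProp36_eq_ofChart (𝒢 : ProfiniteSemiGraph.{u}) (h36 : 𝒢.Prop36Hypotheses)
    (Sigma SigmaHat : Set ℕ) (hsub : Sigma ⊆ SigmaHat) (hne : Sigma.Nonempty)
    (hprime : ∀ p ∈ SigmaHat, p.Prime)
    (TpH : Subgroup (𝒢.temperedPiChart h36).G)
    (HatH : Subgroup (exists_completion_of_prop36 𝒢 h36 (𝒢.temperedPiChart h36)).choose)
    (hle : TpH.map
      (exists_completion_of_prop36 𝒢 h36 (𝒢.temperedPiChart h36)).choose_spec.choose.toMonoidHom ≤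
        HatH) :
    ofProp36 𝒢 h36 Sigma SigmaHat hsub hne hprime TpH HatH hle =
      ofChart 𝒢 h36 (𝒢.temperedPiChart h36) Sigma SigmaHat hsub hne hprime TpH HatH hle :=
  rfl

section

variable (𝒢 : ProfiniteSemiGraph.{u}) (h36 : 𝒢.Prop36Hypotheses) (c : TemperedPiChart 𝒢)
  (Sigma SigmaHat : Set ℕ) (hsub : Sigma ⊆ SigmaHat) (hne : Sigma.Nonempty)
  (hprime : ∀ p ∈ SigmaHat, p.Prime)
  (TpH : Subgroup c.G)
  (HatH : Subgroup (exists_completion_of_prop36 𝒢 h36 c).choose)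
  (hle : TpH.map (exists_completion_of_prop36 𝒢 h36 c).choose_spec.choose.toMonoidHom ≤ HatH)

/-- **`hPC` BY NAME for `ofChart`**: its completion map `ι : Π^tp_𝔾 → Π̂_𝔾` satisfies
`IsProfiniteCompletion`. [cite: MochizukiSemiAnbd2006, Prop 3.6(iii) p.38] -/
theorem ofChart_isProfiniteCompletion :
    IsProfiniteCompletion
      ({ toMonoidHom := (ofChart 𝒢 h36 c Sigma SigmaHat hsub hne hprime TpH HatH hle).ι,
         continuous_toFun :=
           (ofChart 𝒢 h36 c Sigma SigmaHat hsub hne hprime TpH HatH hle).ι_continuous } :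
        (ofChart 𝒢 h36 c Sigma SigmaHat hsub hne hprime TpH HatH hle).Tp →ₜ*
          (ofChart 𝒢 h36 c Sigma SigmaHat hsub hne hprime TpH HatH hle).Hat) := by
  exact (exists_completion_of_prop36 𝒢 h36 c).choose_spec.choose_spec.1

end

end TemperedGraphGroupData

/-! ### Preliminaries on the curve-level interface `TemperedCurve p` -/

namespace StableCurveTemperedData

namespace OfSpecialFibre

variable {p : ℕ} [Fact p.Prime] (X : TemperedCurve p)

/-- The profinite augmentation `Π_{X_K} → G_{ℚ_p}` takes values in `G_K`: the preimage of the closed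
subgroup `G_K` is closed and contains the dense subgroup `Π^temp_{X_K}` (`augHat_comp`, `range_aug`).
[cite: MochizukiSemiAnbd2006, §6 p.69] -/
theorem augHat_mem_GK (g : X.PiHat) : X.augHat g ∈ X.GK := by
  haveI : IsGalois ℚ_[p] (AlgebraicClosure ℚ_[p]) := {}
  haveI := X.finiteDimensional_K
  have hcl : IsClosed ((X.augHat : X.PiHat → GQp p) ⁻¹' (X.GK : Set (GQp p))) :=
    (OpenSubgroup.isClosed ⟨X.GK, IntermediateField.fixingSubgroup_isOpen X.K⟩).preimage
      X.augHat.continuous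
  have hsub : Set.range (X.toHat : X.PiTemp → X.PiHat) ⊆
      (X.augHat : X.PiHat → GQp p) ⁻¹' (X.GK : Set (GQp p)) := by
    rintro _ ⟨h, rfl⟩
    show X.augHat (X.toHat h) ∈ X.GK
    rw [X.augHat_comp]
    change X.aug h ∈ X.K.fixingSubgroup
    rw [← X.range_aug]
    exact ⟨h, rfl⟩
  exact hcl.closure_subset_iff.2 hsub (X.isProfiniteCompletion_toHat.denseRange g)

/-- The profinite augmentation with values in `G_K`. [cite: MochizukiSemiAnbd2006, §6 p.69] -/
def augHatGK : X.PiHat →* X.GK :=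
  X.augHat.toMonoidHom.codRestrict X.GK (augHat_mem_GK X)

/-- `augHatGK ∘ toHat = augGK`. [cite: MochizukiSemiAnbd2006, §6 p.69] -/
theorem augHatGK_comp_toHat : (augHatGK X).comp X.toHat.toMonoidHom = X.augGK.toMonoidHom :=
  MonoidHom.ext fun g => Subtype.ext (by
    change X.augHat (X.toHat g) = X.aug g
    exact X.augHat_comp g)

/-- `Ker(augGK) = Δ^temp_X`. [cite: MochizukiSemiAnbd2006, §6 p.69] -/
theorem ker_augGK_eq_deltaTemp : X.augGK.toMonoidHom.ker = X.DeltaTemp := by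
  ext g
  rw [MonoidHom.mem_ker]
  change X.augGK g = 1 ↔ X.aug g = 1
  constructor
  · intro h
    have := congrArg (fun x : X.GK => (x : GQp p)) h
    simpa using this
  · intro h
    exact Subtype.ext (by simpa using h)

/-- `Ker(augHatGK) = Ker(augHat)`. [cite: MochizukiSemiAnbd2006, §6 p.69] -/
theorem ker_augHatGK_eq : (augHatGK X).ker = X.augHat.toMonoidHom.ker := by
  ext g
  rw [MonoidHom.mem_ker, MonoidHom.mem_ker]
  change (⟨X.augHat g, _⟩ : X.GK) = 1 ↔ X.augHat g = 1
  rw [Subtype.ext_iff]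
  rfl

/-- Under the parameter bundle `d`, `Ker(augHatGK) = Δ_X` (exactness of the completed sequence,
`TemperedCurve.ker_augHat_eq_deltaHat`). [cite: MochizukiSemiAnbd2006, §6 p.69] -/
theorem ker_augHatGK_eq_deltaHat (d : X.GroupLevelData) : (augHatGK X).ker = X.DeltaHat :=
  (ker_augHatGK_eq X).trans (X.ker_augHat_eq_deltaHat d)

variable (d : X.GroupLevelData)

/-- `Ker(augGK) = Δ` of the bridged group-level datum `X.toTemperedArithmeticGroup d`.
[cite: MochizukiSemiAnbd2006, Ex 3.10 p.43] -/
theorem ker_augGK_eq_delta :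
    X.augGK.toMonoidHom.ker = (X.toTemperedArithmeticGroup d).delta :=
  (ker_augGK_eq_deltaTemp X).trans (X.toTemperedArithmeticGroup_delta d).symm

/-- `Δ^temp_X = Δ` of the bridged group-level datum. [cite: MochizukiSemiAnbd2006, Ex 3.10 p.43] -/
theorem deltaTemp_eq_delta : X.DeltaTemp = (X.toTemperedArithmeticGroup d).delta :=
  (X.toTemperedArithmeticGroup_delta d).symm

variable (S : SpecialFibreData (X.toTemperedArithmeticGroup d))

/-- The admissible quotient `Δ^temp_X ↠ π₁^temp(G^c)` read on `Ker(augGK)` — the field `ρTp` below.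
[cite: MochizukiSemiAnbd2006, Ex 3.10 p.45] -/
def rhoTp : X.augGK.toMonoidHom.ker →* S.chart.G :=
  S.admissible.toMonoidHom.comp (MulEquiv.subgroupCongr (ker_augGK_eq_delta X d)).toMonoidHom

/-- `rhoTp` is surjective. [cite: MochizukiSemiAnbd2006, Ex 3.10 p.45] -/
theorem rhoTp_surjective : Function.Surjective (rhoTp X d S) :=
  S.admissible_surjective.comp (MulEquiv.subgroupCongr (ker_augGK_eq_delta X d)).surjective

/-- The admissible quotient read on `Δ^temp_X`, as a CONTINUOUS homomorphism. [cite: MochizukiSemiAnbd2006, Ex 3.10 p.45] -/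
def rhoDelta : X.DeltaTemp →ₜ* S.chart.G where
  toMonoidHom :=
    S.admissible.toMonoidHom.comp (MulEquiv.subgroupCongr (deltaTemp_eq_delta X d)).toMonoidHom
  continuous_toFun := by
    refine S.admissible.continuous.comp ?_
    exact continuous_induced_rng.2 continuous_subtype_val

variable (h36 : S.Gc.Prop36Hypotheses)

/-- The chosen universe-0 profinite completion map `ιG : π₁^temp(G^c) → Π̂_𝔾` of the chart's group.
[cite: MochizukiSemiAnbd2006, Prop 3.6(iii) p.38] -/
def iotaG : S.chart.G →ₜ* (TemperedGraphGroupData.exists_completion_of_prop36 S.Gc h36 S.chart).choose :=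
  (TemperedGraphGroupData.exists_completion_of_prop36 S.Gc h36 S.chart).choose_spec.choose

/-- `ιG` is a profinite completion map. [cite: MochizukiSemiAnbd2006, Prop 3.6(iii) p.38] -/
theorem iotaG_isProfiniteCompletion : IsProfiniteCompletion (iotaG X d S h36) :=
  (TemperedGraphGroupData.exists_completion_of_prop36 S.Gc h36 S.chart).choose_spec.choose_spec.1

/-- Existence of the extension `Δ_X → Π̂_𝔾` of `Δ^temp_X ↠ π₁^temp(G^c) ↪ Π̂_𝔾` along the profinite
completion `Δ^temp_X → Δ_X` (`isProfiniteCompletion_deltaToHat`, `IsProfiniteCompletion.exists_extension`).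
[cite: MochizukiSemiAnbd2006, §6 p.69] -/
theorem exists_rhoHatExt :
    ∃ Φ : X.DeltaHat →ₜ* (TemperedGraphGroupData.exists_completion_of_prop36 S.Gc h36 S.chart).choose,
      ∀ g : X.DeltaTemp, Φ (X.deltaToHat g) = iotaG X d S h36 (rhoDelta X d S g) :=
  (X.isProfiniteCompletion_deltaToHat d).exists_extension ((iotaG X d S h36).comp (rhoDelta X d S))

/-- **`Δ̂_X ↠ Π̂_𝔾` on `Δ_X`**: the (unique) continuous extension of `Δ^temp_X ↠ π₁^temp(G^c) ↪ Π̂_𝔾`.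
([IUTchI] §2 p.47) [claim: Mochizuki2012, status: disputed] -/
def rhoHatExt : X.DeltaHat →ₜ* (TemperedGraphGroupData.exists_completion_of_prop36 S.Gc h36 S.chart).choose :=
  (exists_rhoHatExt X d S h36).choose

/-- The defining property of `rhoHatExt`. ([IUTchI] §2 p.47) [claim: Mochizuki2012, status: disputed] -/
theorem rhoHatExt_deltaToHat (g : X.DeltaTemp) :
    rhoHatExt X d S h36 (X.deltaToHat g) = iotaG X d S h36 (rhoDelta X d S g) :=
  (exists_rhoHatExt X d S h36).choose_spec g

/-- `rhoHatExt` is surjective: its image is compact, hence closed, and contains the dense image of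
`π₁^temp(G^c)` in `Π̂_𝔾`. ([IUTchI] §2 p.47) [claim: Mochizuki2012, status: disputed] -/
theorem rhoHatExt_surjective : Function.Surjective (rhoHatExt X d S h36) := by
  have hΔ := X.isProfiniteCompletion_deltaToHat d
  haveI : CompactSpace X.DeltaHat := hΔ.compactSpace
  have hG := iotaG_isProfiniteCompletion X d S h36
  haveI : T2Space (TemperedGraphGroupData.exists_completion_of_prop36 S.Gc h36 S.chart).choose :=
    hG.t2Space
  have hcl : IsClosed (Set.range (rhoHatExt X d S h36)) :=
    (isCompact_range (rhoHatExt X d S h36).continuous).isClosed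
  have hsub : Set.range (iotaG X d S h36) ⊆ Set.range (rhoHatExt X d S h36) := by
    rintro _ ⟨y, rfl⟩
    obtain ⟨g, rfl⟩ := (S.admissible_surjective.comp
      (MulEquiv.subgroupCongr (deltaTemp_eq_delta X d)).surjective) y
    exact ⟨X.deltaToHat g, rhoHatExt_deltaToHat X d S h36 g⟩
  have hdense : Dense (Set.range (rhoHatExt X d S h36)) := hG.denseRange.mono hsub
  rw [← Set.range_eq_univ, ← hcl.closure_eq]
  exact hdense.closure_eq

/-- **`Δ̂_X ↠ Π̂_𝔾` on `Ker(Π̂_X → G_k)`** (= `Δ_X`, `ker_augHatGK_eq_deltaHat`) — the field `ρHat`.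
([IUTchI] §2 p.47) [claim: Mochizuki2012, status: disputed] -/
def rhoHat : (augHatGK X).ker →* (TemperedGraphGroupData.exists_completion_of_prop36 S.Gc h36 S.chart).choose :=
  (rhoHatExt X d S h36).toMonoidHom.comp
    (MulEquiv.subgroupCongr (ker_augHatGK_eq_deltaHat X d)).toMonoidHom

/-- `rhoHat` is surjective. ([IUTchI] §2 p.47) [claim: Mochizuki2012, status: disputed] -/
theorem rhoHat_surjective : Function.Surjective (rhoHat X d S h36) :=
  (rhoHatExt_surjective X d S h36).comp
    (MulEquiv.subgroupCongr (ker_augHatGK_eq_deltaHat X d)).surjective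

/-- Compatibility `Π^tp_𝔾 ↪ Π̂_𝔾` versus `Δ^tp_X ↪ Δ̂_X`: `ιG (ρTp δ) = ρHat (toHat δ)`.
([IUTchI] §2 p.47) [claim: Mochizuki2012, status: disputed] -/
theorem rhoHat_apply_mk (g : X.augGK.toMonoidHom.ker) (hg : X.toHat (g : X.PiTemp) ∈ (augHatGK X).ker) :
    rhoHat X d S h36 ⟨X.toHat (g : X.PiTemp), hg⟩ = iotaG X d S h36 (rhoTp X d S g) := by
  have hgΔ : (g : X.PiTemp) ∈ X.DeltaTemp := (ker_augGK_eq_deltaTemp X) ▸ g.2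
  have h1 : MulEquiv.subgroupCongr (ker_augHatGK_eq_deltaHat X d) ⟨X.toHat (g : X.PiTemp), hg⟩ =
      X.deltaToHat ⟨(g : X.PiTemp), hgΔ⟩ := Subtype.ext rfl
  change rhoHatExt X d S h36 (MulEquiv.subgroupCongr (ker_augHatGK_eq_deltaHat X d) _) = _
  rw [h1, rhoHatExt_deltaToHat]
  rfl

end OfSpecialFibre

/-! ### The 𝔛-data -/

open OfSpecialFibre

variable {p : ℕ} [Fact p.Prime]

/-- **The [IUTchI] §2 𝔛-data of a tempered curve with special-fibre data** (pp. 46–47): `Π^tp_X :=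
Π^temp_{X_K}`, `Π̂_X := Π_{X_K}` (its profinite completion), `G_k := G_K`, the augmentations,
`𝔾`-data `:= ofChart` of the special-fibre chart (`Π^tp_𝔾 := π₁^temp(G^c)`, `Π̂_𝔾 :=` its profinite
completion), `Δ^tp_X ↠ Π^tp_𝔾 :=` the admissible quotient of `S`, `Δ̂_X ↠ Π̂_𝔾 :=` its profinite
extension (CONSTRUCTED), cusps `:=` the cusps of `X` with `I_x := D_x ∩ Δ^temp_X`, points `:=` the
closed points of `X̄_K` with their decomposition groups `D_x`.  Parameters: `Σ ⊆ Σ̂` with `p ∉ Σ`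
(labels), `Π^tp_ℍ`, `Π̂_ℍ`, and the Cor. 2.3 (vi)(b) atom `cuspMeetsH`.  Model-relative inhabitant
(∀ `X`, `d`, `S`); asserted for no particular curve.  (Reducible, so that instances and coercions on
`X.PiTemp`, `X.GK`, `X.Pt` are seen through the projections.) ([IUTchI] §2 pp.46-47) [claim: Mochizuki2012, status: disputed] -/
@[reducible] def ofSpecialFibre (X : TemperedCurve p) (d : X.GroupLevelData)
    (S : SpecialFibreData (X.toTemperedArithmeticGroup d)) (h36 : S.Gc.Prop36Hypotheses)
    (Sigma SigmaHat : Set ℕ) (hsub : Sigma ⊆ SigmaHat) (hne : Sigma.Nonempty)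
    (hprime : ∀ q ∈ SigmaHat, q.Prime) (hp : p ∉ Sigma)
    (TpH : Subgroup S.chart.G)
    (HatH : Subgroup (TemperedGraphGroupData.exists_completion_of_prop36 S.Gc h36 S.chart).choose)
    (hle : TpH.map (TemperedGraphGroupData.exists_completion_of_prop36 S.Gc h36
      S.chart).choose_spec.choose.toMonoidHom ≤ HatH)
    (cuspMeetsH : {x : X.Pt // X.IsCusp x} → Prop) : StableCurveTemperedData.{0} where
  graph := TemperedGraphGroupData.ofChart S.Gc h36 S.chart Sigma SigmaHat hsub hne hprime TpH HatH hle
  p := p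
  p_notMem := hp
  PiTp := X.PiTemp
  PiHat := X.PiHat
  piHatCompact := X.isProfiniteCompletion_toHat.compactSpace
  Gk := X.GK
  ιX := X.toHat.toMonoidHom
  ιX_continuous := X.toHat.continuous
  ιX_injective := X.toHat_injective
  prTp := X.augGK.toMonoidHom
  prHat := augHatGK X
  prTp_surjective := X.augGK_surjective
  prHat_comp := augHatGK_comp_toHat X
  ρTp := rhoTp X d S
  ρHat := rhoHat X d S h36
  ρTp_surjective := rhoTp_surjective X d S
  ρHat_surjective := rhoHat_surjective X d S h36
  ρ_comp := fun g => (rhoHat_apply_mk X d S h36 g _).symm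
  Cusp := {x : X.Pt // X.IsCusp x}
  inertiaTp := fun x => (X.decomp x.1 ⊓ X.aug.toMonoidHom.ker).subgroupOf X.augGK.toMonoidHom.ker
  cuspMeetsH := cuspMeetsH
  Pt := X.Pt
  decompTp := X.decomp

section

variable (X : TemperedCurve p) (d : X.GroupLevelData)
  (S : SpecialFibreData (X.toTemperedArithmeticGroup d)) (h36 : S.Gc.Prop36Hypotheses)
  (Sigma SigmaHat : Set ℕ) (hsub : Sigma ⊆ SigmaHat) (hne : Sigma.Nonempty)
  (hprime : ∀ q ∈ SigmaHat, q.Prime) (hp : p ∉ Sigma)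
  (TpH : Subgroup S.chart.G)
  (HatH : Subgroup (TemperedGraphGroupData.exists_completion_of_prop36 S.Gc h36 S.chart).choose)
  (hle : TpH.map (TemperedGraphGroupData.exists_completion_of_prop36 S.Gc h36
    S.chart).choose_spec.choose.toMonoidHom ≤ HatH)
  (cuspMeetsH : {x : X.Pt // X.IsCusp x} → Prop)

/-- `Π^tp_X` of the datum IS `Π^temp_{X_K}` (definitional). ([IUTchI] §2 p.46) [claim: Mochizuki2012, status: disputed] -/
theorem ofSpecialFibre_PiTp :
    (ofSpecialFibre X d S h36 Sigma SigmaHat hsub hne hprime hp TpH HatH hle cuspMeetsH).PiTp =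
      X.PiTemp := rfl

/-- The 𝔾-data of the datum IS `ofChart` of the special-fibre chart (definitional).
([IUTchI] §2 p.47) [claim: Mochizuki2012, status: disputed] -/
theorem ofSpecialFibre_graph :
    (ofSpecialFibre X d S h36 Sigma SigmaHat hsub hne hprime hp TpH HatH hle cuspMeetsH).graph =
      TemperedGraphGroupData.ofChart S.Gc h36 S.chart Sigma SigmaHat hsub hne hprime TpH HatH hle :=
  rfl

/-- `Π^tp_𝔾` of the datum IS `π₁^temp(G^c)` in the special-fibre chart (definitional).
([IUTchI] §2 p.47) [claim: Mochizuki2012, status: disputed] -/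
theorem ofSpecialFibre_graph_Tp :
    (ofSpecialFibre X d S h36 Sigma SigmaHat hsub hne hprime hp TpH HatH hle cuspMeetsH).graph.Tp =
      S.chart.G := rfl

/-- `D_x` of the datum IS the interface's decomposition group (definitional). ([IUTchI] §2 p.47) [claim: Mochizuki2012, status: disputed] -/
theorem ofSpecialFibre_decompTp (x : X.Pt) :
    (ofSpecialFibre X d S h36 Sigma SigmaHat hsub hne hprime hp TpH HatH hle cuspMeetsH).decompTp x =
      X.decomp x := rfl

/-- `Δ^tp_X` of the datum is `Δ^temp_X` (as subgroups of `Π^temp_{X_K}`). ([IUTchI] §2 p.46) [claim: Mochizuki2012, status: disputed] -/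
theorem ofSpecialFibre_deltaTp :
    (ofSpecialFibre X d S h36 Sigma SigmaHat hsub hne hprime hp TpH HatH hle cuspMeetsH).DeltaTp =
      X.DeltaTemp := ker_augGK_eq_deltaTemp X

/-- `Δ̂_X` of the datum is `Δ_X`, the closure of `Δ^temp_X` in `Π_{X_K}` (= its profinite completion).
([IUTchI] §2 p.47) [claim: Mochizuki2012, status: disputed] -/
theorem ofSpecialFibre_deltaHat :
    (ofSpecialFibre X d S h36 Sigma SigmaHat hsub hne hprime hp TpH HatH hle cuspMeetsH).DeltaHat =
      X.DeltaHat := ker_augHatGK_eq_deltaHat X d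

/-- `Δ^tp_X ↠ Π^tp_𝔾` of the datum is the admissible quotient of `S` (same underlying element).
([IUTchI] §2 p.47) [claim: Mochizuki2012, status: disputed] -/
theorem ofSpecialFibre_ρTp_apply
    (g : (ofSpecialFibre X d S h36 Sigma SigmaHat hsub hne hprime hp TpH HatH hle cuspMeetsH).DeltaTp) :
    (ofSpecialFibre X d S h36 Sigma SigmaHat hsub hne hprime hp TpH HatH hle cuspMeetsH).ρTp g =
      S.admissible ⟨(g.1 : X.PiTemp), (ker_augGK_eq_delta X d) ▸ g.2⟩ := rfl

/-- The inertia group `I_x` of a cusp of the datum consists of the elements of `D_x ∩ Δ^temp_X`.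
([IUTchI] §2 p.47) [claim: Mochizuki2012, status: disputed] -/
theorem ofSpecialFibre_mem_inertiaTp (x : {x : X.Pt // X.IsCusp x})
    (g : (ofSpecialFibre X d S h36 Sigma SigmaHat hsub hne hprime hp TpH HatH hle cuspMeetsH).DeltaTp) :
    g ∈ (ofSpecialFibre X d S h36 Sigma SigmaHat hsub hne hprime hp TpH HatH hle cuspMeetsH).inertiaTp x
      ↔ (g.1 : X.PiTemp) ∈ X.decomp x.1 ⊓ X.aug.toMonoidHom.ker :=
  Subgroup.mem_subgroupOf

end

end StableCurveTemperedData

end Literature.IUT.HodgeTheaters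

end
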